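import Literature.NumberTheory.Automorphic.HermitianLatticeTreeIsTree      -- ★ A-p17 (g22): `latticeTree`, `isTree_latticeTree`
import HarnessLib

/-!
# The tree of `SL₂` over a local field IS the lattice tree `latticeTree id ϖ J` of the ALTERNATING plane `J = (0 1; −1 0)`
(Serre, *Trees* (1980), Ch. II §1.1, Theorem 1: the graph of lattice classes of `F²` is a tree; `SL₂(F)` acts with two vertex orbits — the classes of
`Λ` with `v(det) ≡ 0` resp. `≡ 1 (mod 2)`)

Topic `NumberTheory/Automorphic`; namespace `Literature.NumberTheory.Automorphic.HermitianLatticeTree`.  KERNEL mathematics only: theorems, no definition, no named fact,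
no instance, no notation, no `sorry`.  Cell `pub/hodgecm-mathlib`, F0∕P3a, crux H413 = `stmt-HodgeConjecture-24833`, line «N6nsGerm», stub `stub_N6nsR2EP :
RankOneEulerPoincareNonsplit`, the WILDLY RAMIFIED places (memo `F0/P3a/F0P3a-p04/g13/MEMO-R2wild.F0P3a-p04g13.md`, ROAD W, brick (W0); seat F0P3a-p04 (g13)).
HONEST LABEL: HC_CM is proved only modulo the printed citations until rung 0 closes; nothing printed is asserted here.

THE OBSERVATION.  A-p17 (g22)'s ★ `latticeTree σ ϖ H` (the tree of self-dual and `ϖ`-modular lattices of a unimodular `σ`-hermitian plane) and its tree theorem ★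
`isTree_latticeTree σ hσv hϖ hH` use `H` ONLY through `IsUnimodular₂ H` — no hermitian symmetry.  Take `σ := RingHom.id F` and the ALTERNATING unimodular matrix
`J := !![0, 1; -1, 0]`.  For `g ∈ GL₂(F)` the Gram matrix is `gᵀ J g = det(g) · J` (§1), so
* `latt g` is «self-dual» iff `|det g| = 1`, «`ϖ`-modular» iff `|det g| = |ϖ|` (§2): the special lattices are ONE REPRESENTATIVE PER HOMOTHETY CLASS of `𝒪`-lattices in `F²`
  (scaling by `ϖ` shifts `v(det)` by `2`), adjacency `ϖL ≤ Λ ≤ L` is Serre's adjacency, and **`latticeTree (RingHom.id F) ϖ J` is the tree `X` of `SL₂(F)`**, a tree by ★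
  `isTree_latticeTree` (§3);
* `unitaryGroupOfForm (RingHom.id F) J = SL₂(F)` (`gᵀ J g = J ⇔ det g = 1`, §1), acting on `X` by ★ `latticeTreeIso` — type-preservingly (★ `latticeTreeColoring_latticeTreeIso`).
USE (memo §1, §3): at EVERY ramified place `w ∣ v` of `E ∕ F` the unitary group `U(Φ₂)(E_w)` acts on THIS tree (over `F_v`) through `SU(Φ₂) = Ad(diag(1,α))⁻¹ SL₂(F_v)` and
`diag(x, σx⁻¹) ↦ [diag(N x, 1)]`, with one vertex orbit, one edge orbit and inversions — the lattice-free road to Kottwitz's Euler–Poincaré relation at the `v ∣ 2` places,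
where the hermitian lattice tree over `E_w` is strictly bigger than the barycentric subdivision of `X`.

## References
* [Serre1980Trees] J.-P. Serre, *Trees* (1980), Ch. II §1.1 (lattices, classes, the tree; Theorem 1), §1.2 (the action of `GL₂`, `SL₂`: two vertex orbits), §1.3.
* [BruhatTits1972] F. Bruhat, J. Tits, *Groupes réductifs sur un corps local I*, Publ. IHÉS 41 (1972), §10 (rank one: the building is a tree).
-/

set_option autoImplicit false

noncomputable section

open scoped ValuativeRel Matrix MatrixGroups
open Matrix ValuativeRel

namespace Literature.NumberTheory.Automorphic.HermitianLatticeTree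

open Literature.NumberTheory.Automorphic Literature.NumberTheory.Automorphic.UnitaryGroup

variable {F : Type*} [Field F] [ValuativeRel F]

/-! ## §1 The alternating plane: `gᵀ J g = det(g) · J`, `U(id, J) = SL₂` -/

omit [ValuativeRel F] in
/-- `gᵀ J g = det(g) · J` for `J = (0 1; −1 0)` and every `g ∈ GL₂(F)` (the Gram matrix of the alternating plane in the basis `g`). [cite: Serre1980Trees, Ch. II §1.2] -/
theorem formCongr_id_altJ (g : GL (Fin 2) F) :
    formCongr (RingHom.id F) g !![(0 : F), 1; -1, 0] = (g : Matrix (Fin 2) (Fin 2) F).det • !![(0 : F), 1; -1, 0] := by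
  have hmap : (g : Matrix (Fin 2) (Fin 2) F).map (RingHom.id F) = (g : Matrix (Fin 2) (Fin 2) F) := by ext; rfl
  rw [formCongr, hmap, Matrix.det_fin_two]
  ext i j
  fin_cases i <;> fin_cases j <;> (simp [Matrix.mul_apply, Fin.sum_univ_two]; try ring)

omit [ValuativeRel F] in
/-- **`U(id, J)(F) = SL₂(F)`**: `g` preserves the alternating form `J` iff `det g = 1`. [cite: Serre1980Trees, Ch. II §1.2] -/
theorem mem_unitaryGroupOfForm_id_altJ_iff (g : GL (Fin 2) F) :
    g ∈ unitaryGroupOfForm (RingHom.id F) !![(0 : F), 1; -1, 0] ↔ (g : Matrix (Fin 2) (Fin 2) F).det = 1 := by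
  have h : g ∈ unitaryGroupOfForm (RingHom.id F) !![(0 : F), 1; -1, 0] ↔ formCongr (RingHom.id F) g !![(0 : F), 1; -1, 0] = !![(0 : F), 1; -1, 0] :=
    mem_unitaryGroupOfForm_iff
  rw [h, formCongr_id_altJ]
  constructor
  · intro hJ
    have h01 := congrFun (congrFun hJ 0) 1
    simpa using h01
  · intro hdet
    rw [hdet, one_smul]

/-! ## §2 Self-dual ⇔ `|det g| = 1`, `ϖ`-modular ⇔ `|det g| = |ϖ|` -/

/-- `c · J` is unimodular iff `|c| = 1` (entries `0, ±c`; determinant `c²`). [cite: Serre1980Trees, Ch. II §1.1] -/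
theorem isUnimodular₂_smul_altJ_iff (c : F) : IsUnimodular₂ (c • !![(0 : F), 1; -1, 0]) ↔ valuation F c = 1 := by
  have hdet : (c • !![(0 : F), 1; -1, 0]).det = c ^ 2 := by
    rw [Matrix.det_smul, Matrix.det_fin_two_of]; simp
  constructor
  · rintro ⟨-, hd⟩
    rw [hdet, map_pow] at hd
    exact (pow_eq_one_iff.1 hd).resolve_right two_ne_zero
  · intro hc
    refine ⟨fun i j => ?_, ?_⟩
    · have hcO : c ∈ 𝒪[F] := (Valuation.mem_integer_iff _ _).2 hc.le
      fin_cases i <;> fin_cases j <;> simp [Matrix.smul_apply] <;> exact hcO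
    · rw [hdet, map_pow, hc, one_pow]

/-- `J = (0 1; −1 0)` is unimodular. [cite: Serre1980Trees, Ch. II §1.1] -/
theorem isUnimodular₂_altJ : IsUnimodular₂ (!![(0 : F), 1; -1, 0] : Matrix (Fin 2) (Fin 2) F) := by
  simpa only [one_smul] using (isUnimodular₂_smul_altJ_iff (1 : F)).2 (map_one _)

/-- **«Self-dual» for `(id, J)` = determinant a unit**: `IsSelfDualLattice id J M ↔ M = latt g` for some `g ∈ GL₂(F)` with `|det g| = 1` — the even vertices of Serre's tree,
one representative per class. [cite: Serre1980Trees, Ch. II §1.1 Theorem 1 and §1.2] -/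
theorem isSelfDualLattice_id_altJ_iff (M : Submodule 𝒪[F] (Fin 2 → F)) :
    IsSelfDualLattice (RingHom.id F) !![(0 : F), 1; -1, 0] M ↔
      ∃ g : GL (Fin 2) F, M = latt (g : Matrix (Fin 2) (Fin 2) F) ∧ valuation F (g : Matrix (Fin 2) (Fin 2) F).det = 1 := by
  simp only [IsSelfDualLattice, formCongr_id_altJ, isUnimodular₂_smul_altJ_iff]

/-- **«`ϖ`-modular» for `(id, J)` = determinant of valuation `|ϖ|`**: `IsModularLattice id ϖ J M ↔ M = latt g` with `|det g| = |ϖ|` — the odd vertices of Serre's tree.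
[cite: Serre1980Trees, Ch. II §1.1 Theorem 1 and §1.2] -/
theorem isModularLattice_id_altJ_iff {ϖ : F} (hϖ : ϖ ≠ 0) (M : Submodule 𝒪[F] (Fin 2 → F)) :
    IsModularLattice (RingHom.id F) ϖ !![(0 : F), 1; -1, 0] M ↔
      ∃ g : GL (Fin 2) F, M = latt (g : Matrix (Fin 2) (Fin 2) F) ∧ valuation F (g : Matrix (Fin 2) (Fin 2) F).det = valuation F ϖ := by
  have hvϖ : valuation F ϖ ≠ 0 := (Valuation.ne_zero_iff _).2 hϖ
  simp only [IsModularLattice, formCongr_id_altJ, smul_smul, isUnimodular₂_smul_altJ_iff, map_mul, map_inv₀]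
  refine exists_congr fun g => and_congr_right fun _ => ?_
  rw [inv_mul_eq_one₀ hvϖ, eq_comm]

/-! ## §3 The tree of `SL₂(F)` -/

/-- **THE TREE OF `SL₂` OVER A LOCAL FIELD** (Serre, *Trees* II.1.1 Theorem 1), as an instance of A-p17's lattice tree: for a uniformizing `ϖ` of the discretely valued
field `F`, `latticeTree (RingHom.id F) ϖ (0 1; −1 0)` — vertices the lattices `latt g` with `|det g| ∈ {1, |ϖ|}` (one per homothety class), edges `ϖL ≤ Λ ≤ L` — is a TREE.
[cite: Serre1980Trees, Ch. II §1.1 Theorem 1] [cite: BruhatTits1972, §10] -/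
theorem isTree_latticeTree_id_altJ [IsDiscreteValuationRing 𝒪[F]] {ϖ : F} (hϖ : IsUniformizingElement ϖ) :
    (latticeTree (RingHom.id F) ϖ !![(0 : F), 1; -1, 0]).IsTree :=
  isTree_latticeTree (RingHom.id F) (fun _ => rfl) hϖ isUnimodular₂_altJ

end Literature.NumberTheory.Automorphic.HermitianLatticeTree
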